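import Mathlib
import HarnessLib
import Literature.NumberTheory.LFunctions.HallTenenbaumTheorem01
import Literature.NumberTheory.LFunctions.MertensElementary
import Literature.NumberTheory.LFunctions.MertensTail
import Summits.Parity.BatemanHorn.Theorems.AlmostPrimeZerosLinearCappedRepulsionRankinMajorant

/-!
# Rough capped statistic of the integers: Hall–Tenenbaum Theorem 01 applied (line `smooth-rough-lattice-acquisition`)

Crux `AlmostPrimeZeros.SystemZeroRepulsion` (stmt-Parity-11291), stub S6 `stub_roughMajorant`, linear system
`f = (X)`, real axis.  For the rough capped statistic with real threshold `Y`,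
`s♯(n) = Σ_{p^v ∥ n, Y < p} min(v,2)`, the function `g(n) = t^{s♯(n)}` (`t ≥ 1`) is non-negative multiplicative with
`g(p) ≤ t`, `g(p^ν) ≤ t²`, so Hall–Tenenbaum's Theorem 01 (tree: `HallTenenbaum.theorem01`, Chebyshev for (0.5),
`hypB_of_le_one` for (0.6)) and (0.4) (`HallTenenbaum.sum_div_le_prod_tsum`) give
`Σ_{1≤n≤x} t^{s♯(n)} ≤ (t log 4 + t² B₁ + 1)(x/log x) ∏_{p≤x} F_p` with explicit local factors
`F_p ≤ exp(a_p/p + 2a_p²/p²)`, `a_p = t` (`Y < p`), `a_p = 1` (`p ≤ Y`).  The companion file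
`…RoughMomentLinearReal.lean` evaluates the product by Mertens.  Reference: Hall–Tenenbaum, *Divisors* (1988), Thm 01.
-/

noncomputable section

open Finset Real

namespace Summit.Parity.BatemanHorn.Cruxes.SystemZeroRepulsion.SmoothRoughLatticeAcquisition

/-- The rough capped statistic at a prime power: `s♯(p^ν) = min(ν,2)` if `Y < p`, else `0`. -/
private theorem rough_prime_pow (Y : ℝ) {p : ℕ} (hp : p.Prime) (ν : ℕ) :
    ((p ^ ν).factorization.sum fun q v => if Y < (q : ℝ) then min v 2 else 0) =
      if Y < (p : ℝ) then min ν 2 else 0 := by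
  rw [hp.factorization_pow, Finsupp.sum_single_index]
  simp

/-- The rough capped statistic is additive over coprime factors. -/
private theorem rough_mul_of_coprime (Y : ℝ) {m n : ℕ} (hmn : m.Coprime n) :
    ((m * n).factorization.sum fun q v => if Y < (q : ℝ) then min v 2 else 0) =
      (m.factorization.sum fun q v => if Y < (q : ℝ) then min v 2 else 0) +
        (n.factorization.sum fun q v => if Y < (q : ℝ) then min v 2 else 0) := by
  rw [Nat.factorization_mul_of_coprime hmn, Finsupp.sum_add_index_of_disjoint]
  rw [Nat.support_factorization, Nat.support_factorization]
  exact hmn.disjoint_primeFactors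

/-- `(1 − u)⁻¹ ≤ 1 + u + 2u² ≤ exp(u + 2u²)` for `0 ≤ u ≤ 1/2`. -/
private theorem inv_one_sub_le_exp {u : ℝ} (hu : u ≤ 1 / 2) :
    (1 - u)⁻¹ ≤ Real.exp (u + 2 * u ^ 2) := by
  have h1 : 0 < 1 - u := by linarith
  have h2 : (1 - u)⁻¹ ≤ 1 + (u + 2 * u ^ 2) := by
    rw [inv_le_iff_one_le_mul₀ h1]
    nlinarith
  have h3 : u + 2 * u ^ 2 + 1 ≤ Real.exp (u + 2 * u ^ 2) := Real.add_one_le_exp _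
  linarith

/-- The local Euler factor of `n ↦ t^{s♯(n)}/n` at a prime `p`, summed: for `Y < p` it is
`t²/p² (1 − 1/p)⁻¹ + 1 + t/p`, for `p ≤ Y` it is `(1 − 1/p)⁻¹`; in both cases it is at most
`exp(a/p + 2a²/p²)` with `a = t` resp. `a = 1`. -/
private theorem tsum_roughFactor_le (Y : ℝ) {p : ℕ} (hp : p.Prime) {t : ℝ} (ht : 1 ≤ t) :
    Summable (fun ν : ℕ => t ^ (if Y < (p : ℝ) then min ν 2 else 0) / (p : ℝ) ^ ν) ∧
    ∑' ν : ℕ, t ^ (if Y < (p : ℝ) then min ν 2 else 0) / (p : ℝ) ^ ν ≤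
      Real.exp ((if Y < (p : ℝ) then t else 1) / p + 2 * (if Y < (p : ℝ) then t else 1) ^ 2 / (p : ℝ) ^ 2) := by
  have hp0 : (0 : ℝ) < p := by exact_mod_cast hp.pos
  have hp2 : (2 : ℝ) ≤ p := by exact_mod_cast hp.two_le
  have hip : 1 / (p : ℝ) ≤ 1 / 2 := one_div_le_one_div_of_le two_pos hp2
  have hip0 : 0 ≤ 1 / (p : ℝ) := by positivity
  by_cases hY : Y < (p : ℝ)
  · simp only [hY, if_true]
    have hs := Summit.Parity.BatemanHorn.Cruxes.LinearCappedRepulsion.JensenStieltjesMajorant.hasSum_localFactor hp t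
    refine ⟨hs.summable, ?_⟩
    rw [hs.tsum_eq]
    have ht0 : 0 ≤ t := by linarith
    have hinv : (1 - 1 / (p : ℝ))⁻¹ ≤ 2 := by
      have hpos : 0 < 1 - 1 / (p : ℝ) := by linarith
      rw [inv_le_comm₀ hpos two_pos]; linarith
    have h1 : t ^ 2 / (p : ℝ) ^ 2 * (1 - 1 / (p : ℝ))⁻¹ + (1 + t / p) ≤
        1 + (t / p + 2 * t ^ 2 / (p : ℝ) ^ 2) := by
      have h0 : 0 ≤ t ^ 2 / (p : ℝ) ^ 2 := by positivity
      have h2 := mul_le_mul_of_nonneg_left hinv h0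
      have e2 : 2 * t ^ 2 / (p : ℝ) ^ 2 = t ^ 2 / (p : ℝ) ^ 2 * 2 := by ring
      rw [e2]
      linarith
    exact h1.trans (by linarith [Real.add_one_le_exp (t / p + 2 * t ^ 2 / (p : ℝ) ^ 2)])
  · simp only [hY, if_false, pow_zero, one_pow]
    have hgeom := hasSum_geometric_of_lt_one hip0 (lt_of_le_of_lt hip (by norm_num))
    have hfun : (fun ν : ℕ => (1 : ℝ) / (p : ℝ) ^ ν) = fun ν : ℕ => (1 / (p : ℝ)) ^ ν := by
      funext ν; rw [one_div_pow]
    rw [hfun]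
    refine ⟨hgeom.summable, ?_⟩
    rw [hgeom.tsum_eq]
    have h := inv_one_sub_le_exp hip
    have e : (1 : ℝ) / p + 2 * 1 / (p : ℝ) ^ 2 = 1 / p + 2 * (1 / (p : ℝ)) ^ 2 := by
      rw [one_div_pow]; ring
    rw [e]; exact h

/-- **Stub `stub_sumRoughLeProd` — Hall–Tenenbaum Theorem 01 applied to `g(n) = t^{s♯(n)}`** (rough capped
statistic with real threshold `Y`): for natural `x ≥ 2` and `t ≥ 1`,
`Σ_{1 ≤ n ≤ x} t^{s♯(n)} ≤ (t log 4 + t² B₁ + 1) (x / log x) ∏_{p ≤ x} F_p`, with the local factors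
bounded as in `tsum_roughFactor_le`. -/
theorem stub_sumRoughLeProd :
    ∀ (Y : ℝ) (x : ℕ), 2 ≤ x → ∀ (t : ℝ), 1 ≤ t →
    ∑ n ∈ Icc 1 x, t ^ (n.factorization.sum fun q v => if Y < (q : ℝ) then min v 2 else 0) ≤
      (t * Real.log 4 + t ^ 2 * Literature.NumberTheory.LFunctions.HallTenenbaum.B₁ + 1) *
        ((x : ℝ) / Real.log x) *
        ∏ p ∈ Nat.primesLE x,
          Real.exp ((if Y < (p : ℝ) then t else 1) / p + 2 * (if Y < (p : ℝ) then t else 1) ^ 2 / (p : ℝ) ^ 2) := by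
  intro Y x hx t ht
  set g : ℕ → ℝ := fun n => t ^ (n.factorization.sum fun q v => if Y < (q : ℝ) then min v 2 else 0) with hg
  have ht0 : 0 ≤ t := by linarith
  have hg0 : ∀ n, 0 ≤ g n := fun n => pow_nonneg ht0 _
  have hg1 : g 1 = 1 := by simp [hg]
  have hmul : ∀ m n, Nat.Coprime m n → g (m * n) = g m * g n := by
    intro m n hmn
    simp only [hg]
    rw [rough_mul_of_coprime Y hmn, pow_add]
  have hgpow : ∀ {p : ℕ}, p.Prime → ∀ ν : ℕ, g (p ^ ν) = t ^ (if Y < (p : ℝ) then min ν 2 else 0) := by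
    intro p hp ν
    simp only [hg]
    rw [rough_prime_pow Y hp]
  -- `g(p) ≤ t` and `g(p^ν) ≤ t²`
  have hgp : ∀ {p : ℕ}, p.Prime → g p ≤ t := by
    intro p hp
    have h := hgpow hp 1
    rw [pow_one] at h
    rw [h]
    split_ifs
    · simp
    · simp only [pow_zero]; exact ht
  have hgpν : ∀ {p : ℕ}, p.Prime → ∀ ν : ℕ, g (p ^ ν) ≤ t ^ 2 := by
    intro p hp ν
    rw [hgpow hp ν]
    split_ifs
    · exact pow_le_pow_right₀ ht (min_le_right _ _)
    · rw [pow_zero]; exact one_le_pow₀ ht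
  -- hypothesis (0.5): `Σ_{p ≤ y} g(p) log p ≤ t θ(y) ≤ (t log 4) y`
  have hA : ∀ y : ℝ, 0 ≤ y → ∑ p ∈ Nat.primesLE ⌊y⌋₊, g p * Real.log p ≤ t * Real.log 4 * y := by
    intro y hy
    calc ∑ p ∈ Nat.primesLE ⌊y⌋₊, g p * Real.log p ≤ ∑ p ∈ Nat.primesLE ⌊y⌋₊, t * Real.log p := by
          refine Finset.sum_le_sum fun p hp => ?_
          exact mul_le_mul_of_nonneg_right (hgp (Nat.prime_of_mem_primesLE hp))
            (Real.log_natCast_nonneg p)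
      _ = t * Chebyshev.theta y := by rw [Chebyshev.theta_eq_sum_primesLE, Finset.mul_sum]
      _ ≤ t * (Real.log 4 * y) := mul_le_mul_of_nonneg_left (Chebyshev.theta_le_log4_mul_x hy) ht0
      _ = t * Real.log 4 * y := by ring
  -- hypothesis (0.6): `Σ_p Σ_{ν≥2} g(p^ν) p^{-ν} log p^ν ≤ t² B₁`
  have hB : ∀ Yn : ℕ, ∑ p ∈ Nat.primesLE Yn, ∑ ν ∈ Icc 2 Yn, g (p ^ ν) / (p : ℝ) ^ ν * Real.log ((p : ℝ) ^ ν) ≤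
      t ^ 2 * Literature.NumberTheory.LFunctions.HallTenenbaum.B₁ := by
    intro Yn
    have hone := Literature.NumberTheory.LFunctions.HallTenenbaum.hypB_of_le_one
      (f := fun _ : ℕ => (1 : ℝ)) (fun _ => le_rfl) Yn
    calc ∑ p ∈ Nat.primesLE Yn, ∑ ν ∈ Icc 2 Yn, g (p ^ ν) / (p : ℝ) ^ ν * Real.log ((p : ℝ) ^ ν)
        ≤ ∑ p ∈ Nat.primesLE Yn, ∑ ν ∈ Icc 2 Yn,
            t ^ 2 * ((fun _ : ℕ => (1 : ℝ)) (p ^ ν) / (p : ℝ) ^ ν * Real.log ((p : ℝ) ^ ν)) := by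
          refine Finset.sum_le_sum fun p hp => Finset.sum_le_sum fun ν _ => ?_
          have hp' := Nat.prime_of_mem_primesLE hp
          have hp1 : (1 : ℝ) ≤ p := by exact_mod_cast hp'.one_lt.le
          have hlog : 0 ≤ Real.log ((p : ℝ) ^ ν) := Real.log_nonneg (one_le_pow₀ hp1)
          have hpow : (0 : ℝ) < (p : ℝ) ^ ν := by positivity
          calc g (p ^ ν) / (p : ℝ) ^ ν * Real.log ((p : ℝ) ^ ν)
              ≤ t ^ 2 / (p : ℝ) ^ ν * Real.log ((p : ℝ) ^ ν) := by
                refine mul_le_mul_of_nonneg_right ?_ hlog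
                exact div_le_div_of_nonneg_right (hgpν hp' ν) hpow.le
            _ = t ^ 2 * ((1 : ℝ) / (p : ℝ) ^ ν * Real.log ((p : ℝ) ^ ν)) := by ring
      _ = t ^ 2 * ∑ p ∈ Nat.primesLE Yn, ∑ ν ∈ Icc 2 Yn,
            (fun _ : ℕ => (1 : ℝ)) (p ^ ν) / (p : ℝ) ^ ν * Real.log ((p : ℝ) ^ ν) := by
          rw [Finset.mul_sum]
          refine Finset.sum_congr rfl fun p _ => ?_
          rw [Finset.mul_sum]
      _ ≤ t ^ 2 * Literature.NumberTheory.LFunctions.HallTenenbaum.B₁ :=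
          mul_le_mul_of_nonneg_left hone (by positivity)
  -- Theorem 01
  have hx1 : (1 : ℝ) < x := by exact_mod_cast lt_of_lt_of_le one_lt_two hx
  have h01 := Literature.NumberTheory.LFunctions.HallTenenbaum.theorem01 hg1 hmul hg0 hA hB hx1
  rw [Nat.floor_natCast] at h01
  -- (0.4) and the local factors
  have hsum : ∀ p : ℕ, p.Prime → Summable (fun ν : ℕ => g (p ^ ν) / (p : ℝ) ^ ν) := by
    intro p hp
    have e : (fun ν : ℕ => g (p ^ ν) / (p : ℝ) ^ ν) =
        fun ν : ℕ => t ^ (if Y < (p : ℝ) then min ν 2 else 0) / (p : ℝ) ^ ν := by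
      funext ν; rw [hgpow hp ν]
    rw [e]; exact (tsum_roughFactor_le Y hp ht).1
  have h04 := Literature.NumberTheory.LFunctions.HallTenenbaum.sum_div_le_prod_tsum hg1 hmul hg0 hsum x
  have hprod : ∏ p ∈ Nat.primesLE x, ∑' ν : ℕ, g (p ^ ν) / (p : ℝ) ^ ν ≤
      ∏ p ∈ Nat.primesLE x,
        Real.exp ((if Y < (p : ℝ) then t else 1) / p + 2 * (if Y < (p : ℝ) then t else 1) ^ 2 / (p : ℝ) ^ 2) := by
    refine Finset.prod_le_prod (fun p _ => tsum_nonneg fun ν => div_nonneg (hg0 _) (by positivity)) ?_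
    intro p hp
    have hp' := Nat.prime_of_mem_primesLE hp
    have e : (fun ν : ℕ => g (p ^ ν) / (p : ℝ) ^ ν) =
        fun ν : ℕ => t ^ (if Y < (p : ℝ) then min ν 2 else 0) / (p : ℝ) ^ ν := by
      funext ν; rw [hgpow hp' ν]
    rw [e]; exact (tsum_roughFactor_le Y hp' ht).2
  have hcoef : 0 ≤ (t * Real.log 4 + t ^ 2 * Literature.NumberTheory.LFunctions.HallTenenbaum.B₁ + 1) *
      ((x : ℝ) / Real.log x) := by
    have := Literature.NumberTheory.LFunctions.HallTenenbaum.B₁_nonneg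
    have hlog4 : 0 ≤ Real.log 4 := Real.log_nonneg (by norm_num)
    have hx0 : 0 ≤ (x : ℝ) / Real.log x := div_nonneg (by positivity) (Real.log_nonneg hx1.le)
    positivity
  calc ∑ n ∈ Icc 1 x, g n
      ≤ (t * Real.log 4 + t ^ 2 * Literature.NumberTheory.LFunctions.HallTenenbaum.B₁ + 1) *
          ((x : ℝ) / Real.log x) * ∑ n ∈ Icc 1 x, g n / n := h01
    _ ≤ (t * Real.log 4 + t ^ 2 * Literature.NumberTheory.LFunctions.HallTenenbaum.B₁ + 1) *
          ((x : ℝ) / Real.log x) * ∏ p ∈ Nat.primesLE x, ∑' ν : ℕ, g (p ^ ν) / (p : ℝ) ^ ν :=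
        mul_le_mul_of_nonneg_left h04 hcoef
    _ ≤ _ := mul_le_mul_of_nonneg_left hprod hcoef


end Summit.Parity.BatemanHorn.Cruxes.SystemZeroRepulsion.SmoothRoughLatticeAcquisition

end
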